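/-
Copyright (c) 2026. All rights reserved.
Released under Apache 2.0 license as described in the file LICENSE.
Authors: HodgeCM publication cell (pub/hodgecm-mathlib), Track B, seat K2E3-p25 (g0).
-/
import Summits.HodgeConjecture.HodgeConjecture.Theorems.K2E3GL3BruhatCellFunctionalsCycles    -- ★ E3β₃b
import Summits.HodgeConjecture.HodgeConjecture.Theorems.K2E3GL3BruhatCellFunctionalsExtremes  -- ★ E3β₃c
import Summits.HodgeConjecture.HodgeConjecture.Theorems.K2E3JacquetFiltrationMultiplicity     -- ★ E3α
import Summits.HodgeConjecture.HodgeConjecture.Theorems.K2E3GLnPrincipalBlockEmbedding        -- ★ `levi_id_mul_comm`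
import HarnessLib

/-!
# K2_E3 road (h413), leaf (nsc-S-A′), brick E3δ — THE GEOMETRIC LEMMA FOR THE BOREL OF `GL₃`: the exponents of `Ind_B^{GL₃} χ` are the six `χ ∘ Ad(P_w)`, with multiplicity
Cell `pub/hodgecm-mathlib` (D-0151), Track B, seat K2E3-p25 (g0).  `--supports stmt-HodgeConjecture-24833 --as helper`; THEOREMS ONLY; COUNT-NEUTRAL.
Assembly of ★ E3α (`finrank_weightSpace_eq_card_of_lineFiltration`) with the six per-cell lines of ★ E3β₃a∕b∕c along the Bruhat filtration ordered by ★ `cellKey id`: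
**`r_U(Ind_B^{GL₃} χδ^{1/2})` is finite-dimensional and, for every `η : T → ℂ`, the generalised `η`-weight space of the normalised Jacquet action has dimension
`#{w ∈ S₃ : η = χ ∘ levi ∘ Ad(P_w) ∘ diag}`** ([BernsteinZelevinsky1977, Thm. 5.2 «geometric lemma» for `(B,B)`]; [Casselman1995, Thm. 6.3.5]).
HONEST LABEL: HC_CM is proved only modulo the 7 printed citations (2 remaining named inputs: hLiu418 = stmt-HodgeConjecture-24832, h413 = stmt-HodgeConjecture-24833) until rung 0 closes.
## References
* [BernsteinZelevinsky1977] I. N. Bernstein, A. V. Zelevinsky, *Induced representations of reductive p-adic groups I*, Ann. Sci. ÉNS 10 (1977), §2.12, Thm. 5.2.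
* [Casselman1995] W. Casselman, *Introduction to the theory of admissible representations of p-adic reductive groups* (draft 1995), §6.3, Thm. 6.3.5.
-/

set_option autoImplicit false
set_option linter.dupNamespace false

noncomputable section

open Set Function MeasureTheory Representation Module
open scoped MatrixGroups

namespace Summit.HodgeConjecture.HodgeConjecture.Cruxes.H413.K2E3GL3BorelJacquetExponents

open Literature.NumberTheory.Automorphic ValuativeRel
open Summit.HodgeConjecture.HodgeConjecture.Cruxes.H413.K2E3GL3BruhatCellFunctionals
open Summit.HodgeConjecture.HodgeConjecture.Cruxes.H413.K2E3GL3BruhatCellFunctionalsCycles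
open Summit.HodgeConjecture.HodgeConjecture.Cruxes.H413.K2E3GL3BruhatCellFunctionalsExtremes
open Summit.HodgeConjecture.HodgeConjecture.Cruxes.H413.K2E3BorelCellJacquetLine
open Summit.HodgeConjecture.HodgeConjecture.Cruxes.H413.K2E3JacquetFiltrationMultiplicity

variable {F : Type} [Field F] [ValuativeRel F] [TopologicalSpace F] [IsNonarchimedeanLocalField F]

/-! ## §1 The six permutations; the per-cell line for every `w ∈ S₃` -/

omit [ValuativeRel F] [TopologicalSpace F] [IsNonarchimedeanLocalField F] [Field F] in
/-- `S₃ = {1, (01), (12), (01)(12), (12)(01), w₀}`. [folklore] -/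
theorem perm_fin_three_cases (w : Equiv.Perm (Fin 3)) :
    w = 1 ∨ w = Equiv.swap (0 : Fin 3) 1 ∨ w = Equiv.swap (1 : Fin 3) 2 ∨ w = Equiv.swap (0 : Fin 3) 1 * Equiv.swap (1 : Fin 3) 2 ∨
      w = Equiv.swap (1 : Fin 3) 2 * Equiv.swap (0 : Fin 3) 1 ∨ w = Fin.revPerm := by
  revert w
  decide

/-- **Every Bruhat cell of `GL₃` contributes exactly a line to `r_U(Ind_B χδ^{1/2})`, with exponent `χ ∘ Ad(P_w)`** (the six cases ★ E3β₃a∕b∕c).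
[cite: BernsteinZelevinsky1977, Thm. 5.2] [cite: Casselman1995, §6.3, Thm. 6.3.5] -/
theorem exists_lineFunctional_cell (χ : (Π a : Fin 3, GL {i : Fin 3 // (id : Fin 3 → Fin 3) i = a} F) →* ℂˣ) (hχ : IsOpen (χ.ker : Set (Π a : Fin 3, GL {i : Fin 3 // (id : Fin 3 → Fin 3) i = a} F))) (w : Equiv.Perm (Fin 3)) :
    ∃ Λ : (restrictUnipotentGL F (id : Fin 3 → Fin 3) (smoothIndRep (standardParabolicGL F (id : Fin 3 → Fin 3)) (Representation.twist (((Representation.trivial ℂ (Π a : Fin 3, GL {i : Fin 3 // (id : Fin 3 → Fin 3) i = a} F) ℂ).twist χ).comp (leviProjection F (id : Fin 3 → Fin 3))) (rootDeltaChar (standardParabolicGL F (id : Fin 3 → Fin 3)))))).Coinvariants →ₗ[ℂ] ℂ,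
      (∀ x ∈ ((vanishingOn (standardParabolicGL F (id : Fin 3 → Fin 3)) (Representation.twist (((Representation.trivial ℂ (Π a : Fin 3, GL {i : Fin 3 // (id : Fin 3 → Fin 3) i = a} F) ℂ).twist χ).comp (leviProjection F (id : Fin 3 → Fin 3))) (rootDeltaChar (standardParabolicGL F (id : Fin 3 → Fin 3)))) (cellLT (K := F) (id : Fin 3 → Fin 3) (w))).map (Coinvariants.mk (restrictUnipotentGL F (id : Fin 3 → Fin 3) (smoothIndRep (standardParabolicGL F (id : Fin 3 → Fin 3)) (Representation.twist (((Representation.trivial ℂ (Π a : Fin 3, GL {i : Fin 3 // (id : Fin 3 → Fin 3) i = a} F) ℂ).twist χ).comp (leviProjection F (id : Fin 3 → Fin 3))) (rootDeltaChar (standardParabolicGL F (id : Fin 3 → Fin 3)))))))), Λ x = 0 ↔ x ∈ ((vanishingOn (standardParabolicGL F (id : Fin 3 → Fin 3)) (Representation.twist (((Representation.trivial ℂ (Π a : Fin 3, GL {i : Fin 3 // (id : Fin 3 → Fin 3) i = a} F) ℂ).twist χ).comp (leviProjection F (id : Fin 3 → Fin 3))) (rootDeltaChar (standardParabolicGL F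 (id : Fin 3 → Fin 3)))) (cellLE (K := F) (id : Fin 3 → Fin 3) (w))).map (Coinvariants.mk (restrictUnipotentGL F (id : Fin 3 → Fin 3) (smoothIndRep (standardParabolicGL F (id : Fin 3 → Fin 3)) (Representation.twist (((Representation.trivial ℂ (Π a : Fin 3, GL {i : Fin 3 // (id : Fin 3 → Fin 3) i = a} F) ℂ).twist χ).comp (leviProjection F (id : Fin 3 → Fin 3))) (rootDeltaChar (standardParabolicGL F (id : Fin 3 → Fin 3))))))))) ∧ (∃ x ∈ ((vanishingOn (standardParabolicGL F (id : Fin 3 → Fin 3)) (Representation.twist (((Representation.trivial ℂ (Π a : Fin 3, GL {i : Fin 3 // (id : Fin 3 → Fin 3) i = a} F) ℂ).twist χ).comp (leviProjection F (id : Fin 3 → Fin 3))) (rootDeltaChar (standardParabolicGL F (id : Fin 3 → Fin 3)))) (cellLT (K := F) (id : Fin 3 → Fin 3) (w))).map (Coinvariants.mk (restrictUnipotentGL F (id : Fin 3 → Fin 3) (smoothIndRep (standardParabolicGL F (id : Fin 3 → Fin 3)) (Representation.twist (((Representation.trivial ℂ (Π a : Fin 3, GL {i : Fin 3 // (id : Fin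 3 → Fin 3) i = a} F) ℂ).twist χ).comp (leviProjection F (id : Fin 3 → Fin 3))) (rootDeltaChar (standardParabolicGL F (id : Fin 3 → Fin 3)))))))), Λ x ≠ 0) ∧
      ∀ (m : (Π a : Fin 3, GL {i : Fin 3 // (id : Fin 3 → Fin 3) i = a} F)), ∀ x ∈ ((vanishingOn (standardParabolicGL F (id : Fin 3 → Fin 3)) (Representation.twist (((Representation.trivial ℂ (Π a : Fin 3, GL {i : Fin 3 // (id : Fin 3 → Fin 3) i = a} F) ℂ).twist χ).comp (leviProjection F (id : Fin 3 → Fin 3))) (rootDeltaChar (standardParabolicGL F (id : Fin 3 → Fin 3)))) (cellLT (K := F) (id : Fin 3 → Fin 3) (w))).map (Coinvariants.mk (restrictUnipotentGL F (id : Fin 3 → Fin 3) (smoothIndRep (standardParabolicGL F (id : Fin 3 → Fin 3)) (Representation.twist (((Representation.trivial ℂ (Π a : Fin 3, GL {i : Fin 3 // (id : Fin 3 → Fin 3) i = a} F) ℂ).twist χ).comp (leviProjection F (id : Fin 3 → Fin 3))) (rootDeltaChar (standardParabolicGL F (id : Fin 3 → Fin 3)))))))),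
        Λ (Representation.normalizedJacquetGL F (id : Fin 3 → Fin 3) (smoothIndRep (standardParabolicGL F (id : Fin 3 → Fin 3)) (Representation.twist (((Representation.trivial ℂ (Π a : Fin 3, GL {i : Fin 3 // (id : Fin 3 → Fin 3) i = a} F) ℂ).twist χ).comp (leviProjection F (id : Fin 3 → Fin 3))) (rootDeltaChar (standardParabolicGL F (id : Fin 3 → Fin 3))))) m x) = ((χ (leviProjection F (id : Fin 3 → Fin 3) ⟨(permGL (w) : GL (Fin 3) F) * blockDiagonalGL F (id : Fin 3 → Fin 3) m * (permGL (w) : GL (Fin 3) F)⁻¹, permGL_conj_blockDiagonalGL_mem_borel (w) m⟩) : ℂˣ) : ℂ) * Λ x := by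
  obtain rfl | rfl | rfl | rfl | rfl | rfl := perm_fin_three_cases w
  · exact exists_lineFunctional_cell_one χ hχ
  · exact exists_lineFunctional_cell_swap_zero_one χ hχ
  · exact exists_lineFunctional_cell_swap_one_two χ hχ
  · exact exists_lineFunctional_cell_cycle_one_two_zero χ hχ
  · exact exists_lineFunctional_cell_cycle_two_zero_one χ hχ
  · exact exists_lineFunctional_cell_rev χ hχ

/-- **The Bruhat filtration is torus-stable**: `r(m)` maps `[vanishingOn (cellsBelow D)]` into itself (★ `mul_blockDiagonalGL_mem_cellsBelow`). [cite: BernsteinZelevinsky1977, Thm. 5.2] -/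
theorem normalizedJacquetGL_mem_map_vanishingOn_cellsBelow (χ : (Π a : Fin 3, GL {i : Fin 3 // (id : Fin 3 → Fin 3) i = a} F) →* ℂˣ) (D : Set (ℕ ×ₗ Lex (Fin 3 → Fin 3))) (m : (Π a : Fin 3, GL {i : Fin 3 // (id : Fin 3 → Fin 3) i = a} F))
    {x : (restrictUnipotentGL F (id : Fin 3 → Fin 3) (smoothIndRep (standardParabolicGL F (id : Fin 3 → Fin 3)) (Representation.twist (((Representation.trivial ℂ (Π a : Fin 3, GL {i : Fin 3 // (id : Fin 3 → Fin 3) i = a} F) ℂ).twist χ).comp (leviProjection F (id : Fin 3 → Fin 3))) (rootDeltaChar (standardParabolicGL F (id : Fin 3 → Fin 3)))))).Coinvariants}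
    (hx : x ∈ (vanishingOn (standardParabolicGL F (id : Fin 3 → Fin 3)) (Representation.twist (((Representation.trivial ℂ (Π a : Fin 3, GL {i : Fin 3 // (id : Fin 3 → Fin 3) i = a} F) ℂ).twist χ).comp (leviProjection F (id : Fin 3 → Fin 3))) (rootDeltaChar (standardParabolicGL F (id : Fin 3 → Fin 3)))) (cellsBelow (K := F) (id : Fin 3 → Fin 3) D)).map (Coinvariants.mk (restrictUnipotentGL F (id : Fin 3 → Fin 3) (smoothIndRep (standardParabolicGL F (id : Fin 3 → Fin 3)) (Representation.twist (((Representation.trivial ℂ (Π a : Fin 3, GL {i : Fin 3 // (id : Fin 3 → Fin 3) i = a} F) ℂ).twist χ).comp (leviProjection F (id : Fin 3 → Fin 3))) (rootDeltaChar (standardParabolicGL F (id : Fin 3 → Fin 3)))))))) :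
    Representation.normalizedJacquetGL F (id : Fin 3 → Fin 3) (smoothIndRep (standardParabolicGL F (id : Fin 3 → Fin 3)) (Representation.twist (((Representation.trivial ℂ (Π a : Fin 3, GL {i : Fin 3 // (id : Fin 3 → Fin 3) i = a} F) ℂ).twist χ).comp (leviProjection F (id : Fin 3 → Fin 3))) (rootDeltaChar (standardParabolicGL F (id : Fin 3 → Fin 3))))) m x ∈
      (vanishingOn (standardParabolicGL F (id : Fin 3 → Fin 3)) (Representation.twist (((Representation.trivial ℂ (Π a : Fin 3, GL {i : Fin 3 // (id : Fin 3 → Fin 3) i = a} F) ℂ).twist χ).comp (leviProjection F (id : Fin 3 → Fin 3))) (rootDeltaChar (standardParabolicGL F (id : Fin 3 → Fin 3)))) (cellsBelow (K := F) (id : Fin 3 → Fin 3) D)).map (Coinvariants.mk (restrictUnipotentGL F (id : Fin 3 → Fin 3) (smoothIndRep (standardParabolicGL F (id : Fin 3 → Fin 3)) (Representation.twist (((Representation.trivial ℂ (Π a : Fin 3, GL {i : Fin 3 // (id : Fin 3 → Fin 3) i = a} F) ℂ).twist χ).comp (leviProjection F (id : Fin 3 → Fin 3))) (rootDeltaChar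 (standardParabolicGL F (id : Fin 3 → Fin 3))))))) := by
  obtain ⟨f, hf, rfl⟩ := hx
  rw [Representation.normalizedJacquetGL_mk]
  refine Submodule.smul_mem _ _ ⟨_, fun g hg => ?_, rfl⟩
  rw [toFun_smoothIndRep_apply]
  exact hf _ (mul_blockDiagonalGL_mem_cellsBelow D hg m)

/-! ## §2 The geometric lemma for `(B, B)` in `GL₃` -/

omit [ValuativeRel F] [TopologicalSpace F] [IsNonarchimedeanLocalField F] in
/-- `cellKey id` is injective on `S₃` (its second component is the word `σ⁻¹`). [folklore] -/
theorem cellKey_id_injective : Function.Injective (fun σ : Equiv.Perm (Fin 3) => cellKey (id : Fin 3 → Fin 3) σ) := by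
  intro σ τ h
  have h2 : (id : Fin 3 → Fin 3) ∘ σ.symm = (id : Fin 3 → Fin 3) ∘ τ.symm := by
    have := congrArg (fun x => ofLex (ofLex x).2) h
    simpa [cellKey] using this
  have h3 : σ.symm = τ.symm := Equiv.ext fun i => congrFun h2 i
  simpa using congrArg Equiv.symm h3

set_option maxHeartbeats 800000 in
open scoped Classical in
/-- **THE GEOMETRIC LEMMA FOR THE BOREL OF `GL₃` (exponent multiset of a principal series).**  For a smooth character `χ` of the diagonal torus `T ≅ (F^×)³` and
`I = Ind_B^{GL₃}(χ δ_B^{1/2})` (★ `parabolicIndGL F id (𝟙.twist χ)`, unfolded): the Jacquet module `r_U(I)` is finite-dimensional, and for every `η : T → ℂ` the generalised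
`η`-weight space of the NORMALISED torus action `normalizedJacquetGL F id I` has dimension `#{w ∈ S₃ : η = χ ∘ levi ∘ Ad(P_w) ∘ diag}` — i.e. the exponents of `I` are the six
`w`-conjugates of `χ`, counted with multiplicity. [cite: BernsteinZelevinsky1977, §2.12, Thm. 5.2] [cite: Casselman1995, §6.3, Thm. 6.3.5] -/
theorem finrank_weightSpace_normalizedJacquetGL_principalSeries_three (χ : (Π a : Fin 3, GL {i : Fin 3 // (id : Fin 3 → Fin 3) i = a} F) →* ℂˣ) (hχ : IsOpen (χ.ker : Set (Π a : Fin 3, GL {i : Fin 3 // (id : Fin 3 → Fin 3) i = a} F))) (η : (Π a : Fin 3, GL {i : Fin 3 // (id : Fin 3 → Fin 3) i = a} F) → ℂ) :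
    FiniteDimensional ℂ (restrictUnipotentGL F (id : Fin 3 → Fin 3) (smoothIndRep (standardParabolicGL F (id : Fin 3 → Fin 3)) (Representation.twist (((Representation.trivial ℂ (Π a : Fin 3, GL {i : Fin 3 // (id : Fin 3 → Fin 3) i = a} F) ℂ).twist χ).comp (leviProjection F (id : Fin 3 → Fin 3))) (rootDeltaChar (standardParabolicGL F (id : Fin 3 → Fin 3)))))).Coinvariants ∧
    finrank ℂ ↥(⨅ m, Module.End.maxGenEigenspace (Representation.normalizedJacquetGL F (id : Fin 3 → Fin 3) (smoothIndRep (standardParabolicGL F (id : Fin 3 → Fin 3)) (Representation.twist (((Representation.trivial ℂ (Π a : Fin 3, GL {i : Fin 3 // (id : Fin 3 → Fin 3) i = a} F) ℂ).twist χ).comp (leviProjection F (id : Fin 3 → Fin 3))) (rootDeltaChar (standardParabolicGL F (id : Fin 3 → Fin 3))))) m) (η m)) =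
      ((Finset.univ : Finset (Equiv.Perm (Fin 3))).filter fun w => η = fun m => ((χ (leviProjection F (id : Fin 3 → Fin 3) ⟨(permGL (w) : GL (Fin 3) F) * blockDiagonalGL F (id : Fin 3 → Fin 3) m * (permGL (w) : GL (Fin 3) F)⁻¹, permGL_conj_blockDiagonalGL_mem_borel (w) m⟩) : ℂˣ) : ℂ)).card := by
  classical
  -- the six cell keys in increasing order, and representatives
  let s : Finset (ℕ ×ₗ Lex (Fin 3 → Fin 3)) := Finset.univ.image fun σ : Equiv.Perm (Fin 3) => cellKey (id : Fin 3 → Fin 3) σ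
  have hs : s.card = 6 := by
    rw [Finset.card_image_of_injective _ cellKey_id_injective, Finset.card_univ, Fintype.card_perm, Fintype.card_fin]; rfl
  let k : Fin 6 ↪o ℕ ×ₗ Lex (Fin 3 → Fin 3) := s.orderEmbOfFin hs
  have hkmem : ∀ j : Fin 6, ∃ σ : Equiv.Perm (Fin 3), cellKey (id : Fin 3 → Fin 3) σ = k j := fun j => by
    obtain ⟨σ, -, hσ⟩ := Finset.mem_image.1 (s.orderEmbOfFin_mem hs j)
    exact ⟨σ, hσ⟩
  choose w hw using hkmem
  have hsurj : ∀ τ : Equiv.Perm (Fin 3), ∃ j : Fin 6, cellKey (id : Fin 3 → Fin 3) τ = k j := fun τ => by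
    have hτ : cellKey (id : Fin 3 → Fin 3) τ ∈ Set.range k := by
      rw [Finset.range_orderEmbOfFin, Finset.mem_coe]
      exact Finset.mem_image.2 ⟨τ, Finset.mem_univ _, rfl⟩
    obtain ⟨j, hj⟩ := hτ
    exact ⟨j, hj.symm⟩
  have hwinj : Function.Injective w := fun i j h => k.injective (by rw [← hw i, ← hw j, h])
  -- consecutive keys: `cellLT (w (j+1)) = cellLE (w j)`, `cellLT (w 0) = ∅`, `cellLE (w 5) = univ`
  have hstep : ∀ (j : ℕ) (hj : j + 1 < 6), cellLT (K := F) (id : Fin 3 → Fin 3) (w ⟨j + 1, hj⟩) = cellLE (K := F) (id : Fin 3 → Fin 3) (w ⟨j, by omega⟩) := by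
    intro j hj
    change cellsBelow (K := F) (id : Fin 3 → Fin 3) (Set.Iio (cellKey (id : Fin 3 → Fin 3) (w ⟨j + 1, hj⟩))) =
      cellsBelow (K := F) (id : Fin 3 → Fin 3) (Set.Iic (cellKey (id : Fin 3 → Fin 3) (w ⟨j, by omega⟩)))
    ext g
    simp only [mem_cellsBelow_iff, Set.mem_Iio, Set.mem_Iic, hw]
    refine exists_congr fun τ => and_congr_left fun _ => ?_
    obtain ⟨i, hi⟩ := hsurj τ
    rw [hi, k.lt_iff_lt, k.le_iff_le, Fin.lt_def, Fin.le_def]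
    exact Nat.lt_succ_iff
  have hbot : cellLT (K := F) (id : Fin 3 → Fin 3) (w ⟨0, by omega⟩) = ∅ := by
    refine cellLT_eq_empty (K := F) (id : Fin 3 → Fin 3) fun ⟨τ, hτ⟩ => ?_
    obtain ⟨i, hi⟩ := hsurj τ
    rw [hw, hi, k.lt_iff_lt] at hτ
    exact (not_lt.2 (Fin.zero_le i)) hτ
  have htop : cellLE (K := F) (id : Fin 3 → Fin 3) (w ⟨5, by omega⟩) = Set.univ := by
    refine Set.eq_univ_of_univ_subset ?_
    rw [← cellLE_rev_eq_univ (K := F) (id : Fin 3 → Fin 3) monotone_id]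
    rintro g ⟨τ, hτ, hg⟩
    refine ⟨τ, ?_, hg⟩
    obtain ⟨i, hi⟩ := hsurj Fin.revPerm
    simp only [Set.mem_Iic] at hτ ⊢
    refine hτ.trans ?_
    rw [hi, hw, k.le_iff_le]
    exact Fin.le_last i
  -- the per-cell lines
  have hcell := fun j : Fin 6 => exists_lineFunctional_cell χ hχ (w j)
  choose Λw hkerw hnew hequivw using hcell
  -- the filtration, functionals and characters indexed by `ℕ`
  let Fl : ℕ → Submodule ℂ (restrictUnipotentGL F (id : Fin 3 → Fin 3) (smoothIndRep (standardParabolicGL F (id : Fin 3 → Fin 3)) (Representation.twist (((Representation.trivial ℂ (Π a : Fin 3, GL {i : Fin 3 // (id : Fin 3 → Fin 3) i = a} F) ℂ).twist χ).comp (leviProjection F (id : Fin 3 → Fin 3))) (rootDeltaChar (standardParabolicGL F (id : Fin 3 → Fin 3)))))).Coinvariants := fun j =>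
    if h : j < 6 then ((vanishingOn (standardParabolicGL F (id : Fin 3 → Fin 3)) (Representation.twist (((Representation.trivial ℂ (Π a : Fin 3, GL {i : Fin 3 // (id : Fin 3 → Fin 3) i = a} F) ℂ).twist χ).comp (leviProjection F (id : Fin 3 → Fin 3))) (rootDeltaChar (standardParabolicGL F (id : Fin 3 → Fin 3)))) (cellLT (K := F) (id : Fin 3 → Fin 3) (w ⟨j, h⟩))).map (Coinvariants.mk (restrictUnipotentGL F (id : Fin 3 → Fin 3) (smoothIndRep (standardParabolicGL F (id : Fin 3 → Fin 3)) (Representation.twist (((Representation.trivial ℂ (Π a : Fin 3, GL {i : Fin 3 // (id : Fin 3 → Fin 3) i = a} F) ℂ).twist χ).comp (leviProjection F (id : Fin 3 → Fin 3))) (rootDeltaChar (standardParabolicGL F (id : Fin 3 → Fin 3)))))))) else ⊥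
  have hFl : ∀ (j : ℕ) (h : j < 6), Fl j = ((vanishingOn (standardParabolicGL F (id : Fin 3 → Fin 3)) (Representation.twist (((Representation.trivial ℂ (Π a : Fin 3, GL {i : Fin 3 // (id : Fin 3 → Fin 3) i = a} F) ℂ).twist χ).comp (leviProjection F (id : Fin 3 → Fin 3))) (rootDeltaChar (standardParabolicGL F (id : Fin 3 → Fin 3)))) (cellLT (K := F) (id : Fin 3 → Fin 3) (w ⟨j, h⟩))).map (Coinvariants.mk (restrictUnipotentGL F (id : Fin 3 → Fin 3) (smoothIndRep (standardParabolicGL F (id : Fin 3 → Fin 3)) (Representation.twist (((Representation.trivial ℂ (Π a : Fin 3, GL {i : Fin 3 // (id : Fin 3 → Fin 3) i = a} F) ℂ).twist χ).comp (leviProjection F (id : Fin 3 → Fin 3))) (rootDeltaChar (standardParabolicGL F (id : Fin 3 → Fin 3)))))))) := fun j h => dif_pos h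
  have hFl' : ∀ j : ℕ, ¬ j < 6 → Fl j = ⊥ := fun j h => dif_neg h
  have hFle : ∀ (j : ℕ) (h : j < 6), Fl (j + 1) = ((vanishingOn (standardParabolicGL F (id : Fin 3 → Fin 3)) (Representation.twist (((Representation.trivial ℂ (Π a : Fin 3, GL {i : Fin 3 // (id : Fin 3 → Fin 3) i = a} F) ℂ).twist χ).comp (leviProjection F (id : Fin 3 → Fin 3))) (rootDeltaChar (standardParabolicGL F (id : Fin 3 → Fin 3)))) (cellLE (K := F) (id : Fin 3 → Fin 3) (w ⟨j, h⟩))).map (Coinvariants.mk (restrictUnipotentGL F (id : Fin 3 → Fin 3) (smoothIndRep (standardParabolicGL F (id : Fin 3 → Fin 3)) (Representation.twist (((Representation.trivial ℂ (Π a : Fin 3, GL {i : Fin 3 // (id : Fin 3 → Fin 3) i = a} F) ℂ).twist χ).comp (leviProjection F (id : Fin 3 → Fin 3))) (rootDeltaChar (standardParabolicGL F (id : Fin 3 → Fin 3)))))))) := by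
    intro j h
    by_cases hj : j + 1 < 6
    · rw [hFl _ hj, hstep j hj]
    · have hj5 : j = 5 := by omega
      subst hj5
      rw [hFl' _ hj, htop]
      have hvan : vanishingOn (standardParabolicGL F (id : Fin 3 → Fin 3)) (Representation.twist (((Representation.trivial ℂ (Π a : Fin 3, GL {i : Fin 3 // (id : Fin 3 → Fin 3) i = a} F) ℂ).twist χ).comp (leviProjection F (id : Fin 3 → Fin 3))) (rootDeltaChar (standardParabolicGL F (id : Fin 3 → Fin 3)))) (Set.univ : Set (GL (Fin 3) F)) = ⊥ :=
        eq_bot_iff.2 fun f hf => (Submodule.mem_bot ℂ).2 (SmoothInd.ext (funext fun g => by rw [hf g (Set.mem_univ g)]; rfl))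
      rw [hvan, Submodule.map_bot]
  let conjB : Equiv.Perm (Fin 3) → ((Π a : Fin 3, GL {i : Fin 3 // (id : Fin 3 → Fin 3) i = a} F) →* ↥(standardParabolicGL F (id : Fin 3 → Fin 3))) := fun v =>
    ((MulAut.conj (permGL v : GL (Fin 3) F)).toMonoidHom.comp (blockDiagonalGL F (id : Fin 3 → Fin 3))).codRestrict (standardParabolicGL F (id : Fin 3 → Fin 3))
      (fun m => permGL_conj_blockDiagonalGL_mem_borel v m)
  let cw : Equiv.Perm (Fin 3) → ((Π a : Fin 3, GL {i : Fin 3 // (id : Fin 3 → Fin 3) i = a} F) →* ℂˣ) := fun v => χ.comp ((leviProjection F (id : Fin 3 → Fin 3)).comp (conjB v))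
  have hcw : ∀ (v : Equiv.Perm (Fin 3)) (m : (Π a : Fin 3, GL {i : Fin 3 // (id : Fin 3 → Fin 3) i = a} F)), ((cw v m : ℂˣ) : ℂ) =
      ((χ (leviProjection F (id : Fin 3 → Fin 3) ⟨(permGL v : GL (Fin 3) F) * blockDiagonalGL F (id : Fin 3 → Fin 3) m * (permGL v : GL (Fin 3) F)⁻¹, permGL_conj_blockDiagonalGL_mem_borel v m⟩) : ℂˣ) : ℂ) :=
    fun v m => rfl
  have hcomm : ∀ m m' : (Π a : Fin 3, GL {i : Fin 3 // (id : Fin 3 → Fin 3) i = a} F), Commute (Representation.normalizedJacquetGL F (id : Fin 3 → Fin 3) (smoothIndRep (standardParabolicGL F (id : Fin 3 → Fin 3)) (Representation.twist (((Representation.trivial ℂ (Π a : Fin 3, GL {i : Fin 3 // (id : Fin 3 → Fin 3) i = a} F) ℂ).twist χ).comp (leviProjection F (id : Fin 3 → Fin 3))) (rootDeltaChar (standardParabolicGL F (id : Fin 3 → Fin 3))))) m)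
      (Representation.normalizedJacquetGL F (id : Fin 3 → Fin 3) (smoothIndRep (standardParabolicGL F (id : Fin 3 → Fin 3)) (Representation.twist (((Representation.trivial ℂ (Π a : Fin 3, GL {i : Fin 3 // (id : Fin 3 → Fin 3) i = a} F) ℂ).twist χ).comp (leviProjection F (id : Fin 3 → Fin 3))) (rootDeltaChar (standardParabolicGL F (id : Fin 3 → Fin 3))))) m') := fun m m' => by
    change Representation.normalizedJacquetGL F (id : Fin 3 → Fin 3) (smoothIndRep (standardParabolicGL F (id : Fin 3 → Fin 3)) (Representation.twist (((Representation.trivial ℂ (Π a : Fin 3, GL {i : Fin 3 // (id : Fin 3 → Fin 3) i = a} F) ℂ).twist χ).comp (leviProjection F (id : Fin 3 → Fin 3))) (rootDeltaChar (standardParabolicGL F (id : Fin 3 → Fin 3))))) m * Representation.normalizedJacquetGL F (id : Fin 3 → Fin 3) (smoothIndRep (standardParabolicGL F (id : Fin 3 → Fin 3)) (Representation.twist (((Representation.trivial ℂ (Π a : Fin 3, GL {i : Fin 3 // (id : Fin 3 → Fin 3) i = a} F) ℂ).twist χ).comp (leviProjection F (id : Fin 3 → Fin 3))) (rootDeltaChar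 (standardParabolicGL F (id : Fin 3 → Fin 3))))) m' = _
    rw [← map_mul, K2E3GLnPrincipalBlockEmbedding.levi_id_mul_comm m m', map_mul]
  have h0 : Fl 0 = ⊤ := by
    rw [hFl 0 (by omega), hbot]
    have htop' : vanishingOn (standardParabolicGL F (id : Fin 3 → Fin 3)) (Representation.twist (((Representation.trivial ℂ (Π a : Fin 3, GL {i : Fin 3 // (id : Fin 3 → Fin 3) i = a} F) ℂ).twist χ).comp (leviProjection F (id : Fin 3 → Fin 3))) (rootDeltaChar (standardParabolicGL F (id : Fin 3 → Fin 3)))) (∅ : Set (GL (Fin 3) F)) = ⊤ := eq_top_iff.2 fun f _ g hg => hg.elim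
    rw [htop', Submodule.map_top, LinearMap.range_eq_top]
    exact Coinvariants.mk_surjective _
  have h6 : Fl 6 = ⊥ := hFl' 6 (by omega)
  have hanti : ∀ j, Fl (j + 1) ≤ Fl j := fun j => by
    by_cases h : j < 6
    · rw [hFle j h, hFl j h]
      exact Submodule.map_mono (vanishingOn_mono (cellLT_subset_cellLE (K := F) (id : Fin 3 → Fin 3) _))
    · rw [hFl' (j + 1) (by omega)]; exact bot_le
  have hst : ∀ j m, ∀ x ∈ Fl j, Representation.normalizedJacquetGL F (id : Fin 3 → Fin 3) (smoothIndRep (standardParabolicGL F (id : Fin 3 → Fin 3)) (Representation.twist (((Representation.trivial ℂ (Π a : Fin 3, GL {i : Fin 3 // (id : Fin 3 → Fin 3) i = a} F) ℂ).twist χ).comp (leviProjection F (id : Fin 3 → Fin 3))) (rootDeltaChar (standardParabolicGL F (id : Fin 3 → Fin 3))))) m x ∈ Fl j := fun j m x hx => by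
    by_cases h : j < 6
    · rw [hFl j h] at hx ⊢
      exact normalizedJacquetGL_mem_map_vanishingOn_cellsBelow χ _ m hx
    · rw [hFl' j h] at hx ⊢
      rw [(Submodule.mem_bot ℂ).1 hx, map_zero]; exact Submodule.zero_mem _
  let Λ : ℕ → ((restrictUnipotentGL F (id : Fin 3 → Fin 3) (smoothIndRep (standardParabolicGL F (id : Fin 3 → Fin 3)) (Representation.twist (((Representation.trivial ℂ (Π a : Fin 3, GL {i : Fin 3 // (id : Fin 3 → Fin 3) i = a} F) ℂ).twist χ).comp (leviProjection F (id : Fin 3 → Fin 3))) (rootDeltaChar (standardParabolicGL F (id : Fin 3 → Fin 3)))))).Coinvariants →ₗ[ℂ] ℂ) := fun j => if h : j < 6 then Λw ⟨j, h⟩ else 0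
  let c : ℕ → ((Π a : Fin 3, GL {i : Fin 3 // (id : Fin 3 → Fin 3) i = a} F) →* ℂˣ) := fun j => if h : j < 6 then cw (w ⟨j, h⟩) else 1
  have hΛ : ∀ (j : ℕ) (h : j < 6), Λ j = Λw ⟨j, h⟩ := fun j h => dif_pos h
  have hc : ∀ (j : ℕ) (h : j < 6), c j = cw (w ⟨j, h⟩) := fun j h => dif_pos h
  have hker : ∀ j < 6, ∀ x ∈ Fl j, Λ j x = 0 ↔ x ∈ Fl (j + 1) := fun j hj x hx => by
    rw [hΛ j hj, hFle j hj]
    rw [hFl j hj] at hx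
    exact hkerw ⟨j, hj⟩ x hx
  have hne : ∀ j < 6, ∃ x ∈ Fl j, Λ j x ≠ 0 := fun j hj => by
    rw [hΛ j hj, hFl j hj]
    exact hnew ⟨j, hj⟩
  have hequiv : ∀ j < 6, ∀ m, ∀ x ∈ Fl j, Λ j (Representation.normalizedJacquetGL F (id : Fin 3 → Fin 3) (smoothIndRep (standardParabolicGL F (id : Fin 3 → Fin 3)) (Representation.twist (((Representation.trivial ℂ (Π a : Fin 3, GL {i : Fin 3 // (id : Fin 3 → Fin 3) i = a} F) ℂ).twist χ).comp (leviProjection F (id : Fin 3 → Fin 3))) (rootDeltaChar (standardParabolicGL F (id : Fin 3 → Fin 3))))) m x) = c j m * Λ j x :=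
    fun j hj m x hx => by
    rw [hFl j hj] at hx
    rw [hΛ j hj, hc j hj, hequivw ⟨j, hj⟩ m x hx, hcw]
  obtain ⟨hfd, hcount⟩ := finrank_weightSpace_eq_card_of_lineFiltration (Representation.normalizedJacquetGL F (id : Fin 3 → Fin 3) (smoothIndRep (standardParabolicGL F (id : Fin 3 → Fin 3)) (Representation.twist (((Representation.trivial ℂ (Π a : Fin 3, GL {i : Fin 3 // (id : Fin 3 → Fin 3) i = a} F) ℂ).twist χ).comp (leviProjection F (id : Fin 3 → Fin 3))) (rootDeltaChar (standardParabolicGL F (id : Fin 3 → Fin 3))))))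
    hcomm 6 Fl h0 h6 hanti hst Λ c hker hne hequiv η
  refine ⟨hfd, hcount.trans ?_⟩
  -- reindex the count: `j ↦ w j` is a bijection `range 6 → S₃`
  refine Finset.card_bij (fun (j : ℕ) _ => if h : j < 6 then w ⟨j, h⟩ else 1) ?_ ?_ ?_
  · intro j hj
    obtain ⟨hj6, hη⟩ := Finset.mem_filter.1 hj
    have hj6' : j < 6 := Finset.mem_range.1 hj6
    refine Finset.mem_filter.2 ⟨Finset.mem_univ _, hη.trans (funext fun m => ?_)⟩
    simp only [dif_pos hj6']
    rw [hc _ hj6', hcw]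
  · intro i hi j hj h
    have hi6 : i < 6 := Finset.mem_range.1 (Finset.mem_filter.1 hi).1
    have hj6 : j < 6 := Finset.mem_range.1 (Finset.mem_filter.1 hj).1
    simp only [dif_pos hi6, dif_pos hj6] at h
    exact Fin.mk.inj_iff.1 (hwinj h)
  · intro v hv
    obtain ⟨j, hj⟩ := hsurj v
    have hvw : v = w j := cellKey_id_injective (by simp only [hj, hw])
    subst hvw
    obtain ⟨-, hη⟩ := Finset.mem_filter.1 hv
    refine ⟨j.1, Finset.mem_filter.2 ⟨Finset.mem_range.2 j.2, hη.trans (funext fun m => ?_)⟩, by simp only [dif_pos j.2]⟩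
    rw [hc _ j.2, hcw]

end Summit.HodgeConjecture.HodgeConjecture.Cruxes.H413.K2E3GL3BorelJacquetExponents
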